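import Summits.QuantumFields.BalabanUV.T4Continuum.Support.BalabanBlockPoincare

/-!
# T⁴ programme, spine node NE2 (U1a) — THE MIXED ONE-STEP LAW at `U = 1`:
# `‖𝒢^{(η/R)} QBᴴ − Q_Rᴴ 𝒢^{(η)}‖ ≤ R^{−d/2}·(CQ + 3d·Cst)·η` (Bałaban's `𝒢 = Δ_a^{−1}` (1.83) and averaging (1.18) against
# King's pairing `x′ ↦ x`, the shape of [King1986] Prop. 3.8 (3.71) for the soft minimiser map `a_kG_kQ_k^*`)

Eighth generation of the NE2 prover lineage P1 of the cell `pub-balaban`, file 7 (companion of `Support/BalabanBlockPoincare`).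
The un-sandwiched object of [B5] (1.71)/(1.74) — the SOFT MINIMISER MAP `B ↦ A₀ = a n^d 𝒢 Q_kᴴ B` of the exponent of (1.68)
(King's `a_kG_kQ_k*`, [King1986] (4.2); object X3 of the cell record `t4/T4-XREAD-U1a.md`) — maps the unit lattice INTO the fine
lattice, so its η-comparison needs an injection between consecutive fine lattices; with King's pairing «When x′ ∈ T_{η′}, we
denote by x that point in T_η for which x′ ∈ B^n(x)» (p. 664) the injection is the piecewise-constant extension `R^d Q_Rᴴ`, and
the one-step comparison is the MIXED LAW proved here:

 * **`opNorm_calG_mul_QBH_sub_le`**: `‖𝒢^{(η/R)} QBᴴ − Q_Rᴴ 𝒢^{(η)}‖ ≤ R^{−d/2}·CQH(d,a)·η`, `CQH = CQ + 3d·Cst`, all `N, R ≥ 1`,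
   `a > 0`, every `d`, every torus;
 * the MINIMISER TOWER at `U = 1` (every `L`, torus `M`): `Jpc k = L^{d/2}Q_Lᴴ` (King's pairing as an isometric injection,
   `Jpc_conjTranspose_mul_Jpc`), `Mtil k = n_k^{d/2}·a·𝒢^{(L^{−k})}·QBtow_kᴴ` (the soft minimiser map `B ↦ a n_k^d 𝒢 Q_kᴴ B` of
   (1.68)/(1.71) in the `L²(T_η)` normalisation), **`opNorm_Mtil_succ_sub_le`** `‖M̃_{k+1} − J_k M̃_k‖ ≤ a·CQH·L^{−k}` and
   **`opNorm_Mtil_sub_Jtow_mul_le`** `‖M̃_{k+n} − J_{k,n} M̃_k‖ ≤ a·CQH·L^{−k}/(1 − L^{−1})` (`L ≥ 2`): the minimiser maps form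
   a CAUCHY TOWER MODULO KING's INJECTIONS with rate `L^{−k}` (object X3 of `t4/T4-XREAD-U1a.md` at `U = 1`).

MECHANISM: `𝒢′QBᴴ − Q_Rᴴ𝒢 = (1 − Π)𝒢′QBᴴ + R^d Q_Rᴴ·[Q_R 𝒢′ Lavgᴴ Q_Rᴴ − R^{−d}𝒢]`; the first term is the block Poincaré
inequality (`BalabanBlockPoincare.opNorm_one_sub_Pi_mul_le`, `2d·Cst·η` by (1.89)) times `‖QBᴴ‖ ≤ R^{−d/2}`; the bracket is the
lineage's King-Q law (`opNorm_Qavg_calG_rate`, `CQ·η`) plus ONE straight-contour smoothing (file 2, `d·Cst·η`).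

HONEST FRAMING (T4-DAG p. 1).  `U = 1`, FIXED FINITE torus, linear layer, operator norm; statements and constants OURS
([folklore]); Bałaban prints no rate, King's (3.71) is the scalar A = 0 template.  NOT `U ≠ 1` (open row G-an2-4, typed in
`Spine/CovariantAveragingTower`), NOT infinite volume, NOT a mass gap, NOT Clay, NOT summit progress.  HONEST DEPENDENCY:
continuum YM on T⁴ ⇐ BetaPertH ∧ nine spine estimates (0/9 proved); BetaPertH ⇐ (D1) ∧ (D4) ∧ CAP+tail; G-an2-4 gates asym,
D1 and NE2/3/4.  ABSOLUTE RULE kept; no `sorry`.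
-/

noncomputable section

open scoped BigOperators ComplexConjugate Matrix Matrix.Norms.L2Operator
open Finset

namespace Summit.QuantumFields.BalabanUV.T4Continuum.BalabanMinimizerLaw

open Literature.MathematicalPhysics.QuantumFieldTheory.Balaban1983to89.B5Prop11Plancherel
open Literature.MathematicalPhysics.QuantumFieldTheory.Balaban1983to89.B5G183RateTorus (CT_nonneg)
open Literature.MathematicalPhysics.QuantumFieldTheory.Balaban1983to89.B5G183RateTorusW
open Summit.QuantumFields.BalabanUV.T4Continuum.BalabanLineAverage
open Summit.QuantumFields.BalabanUV.T4Continuum.BalabanBlockPoincare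

variable {d : ℕ}

section TwoLevel

variable (N R : ℕ) [NeZero N] [NeZero R] (M : Fin d → ℕ) [hM : ∀ μ, NeZero (M μ)]

omit [NeZero N] [NeZero R] hM in
/-- the constant of the mixed law: `CQ + 3d·Cst`; OURS. [folklore] -/
def CQH (d : ℕ) (a : ℝ) : ℝ := CQ d a + 3 * d * Cst d a

omit [NeZero N] [NeZero R] hM in
/-- `0 ≤ CQH`. [folklore] -/
theorem CQH_nonneg (d : ℕ) (a : ℝ) : 0 ≤ CQH d a := by
  have h1 : 0 ≤ CQ d a := by
    have := CT_nonneg d a; have := Cst_nonneg d a; rw [CQ]; positivity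
  have := Cst_nonneg d a
  rw [CQH]; positivity

/-- **THE MIXED ONE-STEP LAW at `U = 1`** (finite torus, all `N, R ≥ 1`, `a > 0`, every `d`):
`‖𝒢^{(η/R)} QBᴴ − Q_Rᴴ 𝒢^{(η)}‖ ≤ R^{−d/2}·CQH(d,a)·η` — the fine propagator applied to the adjoint (1.18)-average of a coarse
source is, up to `O(η)` in `ℓ²(T_η) → ℓ²(T_{η/R})` norm (with the natural factor `R^{−d/2} = ‖Q_Rᴴ‖`), King's pairing
`x′ ↦ x` («When x′ ∈ T_{η′}, we denote by x that point in T_η for which x′ ∈ B^n(x)») of the coarse propagator: the shape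
of [King1986] Prop. 3.8 (3.71) for `a_kG_kQ_k^*`, here for Bałaban's vector `𝒢 = Δ_a^{−1}` (1.83) and averaging (1.18), in
operator norm.  Statement and constant OURS. [cite: King1986, Prop. 3.8 (3.71) p.664, (2.10) p.653; Balaban1984PropagatorsI,
(1.18) p.20, (1.83) p.31, Prop. 1.1 (1.89) p.33] [folklore] -/
theorem opNorm_calG_mul_QBH_sub_le (hN : 1 ≤ N) (hR : 1 ≤ R) (hRN : 1 ≤ R * N) (a : ℝ) (ha : 0 < a) :
    ‖calG (R * N) hRN M a ha * (QB N R M)ᴴ - (Qavg N R M)ᴴ * calG N hN M a ha‖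
      ≤ (Real.sqrt ((R : ℝ) ^ d))⁻¹ * CQH d a / N := by
  have hNpos : (0 : ℝ) < N := by exact_mod_cast hN
  have hRpos : (0 : ℝ) < R := by exact_mod_cast hR
  have hRd : (0 : ℝ) < (R : ℝ) ^ d := pow_pos hRpos d
  have hRdC : ((R : ℂ) ^ d) ≠ 0 := pow_ne_zero _ (by exact_mod_cast (NeZero.ne R))
  have hc : (((R * N : ℕ) : ℂ)) ≠ 0 := by exact_mod_cast (Nat.pos_iff_ne_zero.mp hRN)
  have hcn : ‖(((R * N : ℕ) : ℂ))‖ = (R : ℝ) * N := by rw [Complex.norm_natCast]; push_cast; ring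
  have hCst := Cst_nonneg d a
  set G' := calG (R * N) hRN M a ha with hG'
  set G := calG N hN M a ha with hG
  set Q := Qavg N R M with hQ
  set Lv := Lavg (fine (R * N) M) R with hLv
  have hsq : Real.sqrt ((R : ℝ) ^ d) * Real.sqrt ((R : ℝ) ^ d) = (R : ℝ) ^ d := Real.mul_self_sqrt hRd.le
  have hs0 : 0 < Real.sqrt ((R : ℝ) ^ d) := Real.sqrt_pos.mpr hRd
  -- (i) the axis defects of `𝒢′`: `‖(S^ν − 1)𝒢′‖ ≤ Cst/(RN)`
  have hX : ∀ ν, ‖(shiftM (fine (R * N) M) ν - 1) * G'‖ ≤ Cst d a / ((R : ℝ) * N) := by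
    intro ν
    have h := opNorm_shiftM_sub_one_mul_le G' hc ν (opNorm_fdiff_calG_le (R * N) hRN M a ha ν)
    rwa [hcn] at h
  have hδ : 0 ≤ Cst d a / ((R : ℝ) * N) := by positivity
  -- (ii) block Poincaré for `𝒢′`: `‖(1 − Π)𝒢′‖ ≤ 2d·Cst/N`
  have hP : ‖(1 - Pi N R M) * G'‖ ≤ 2 * d * Cst d a / N := by
    refine (opNorm_one_sub_Pi_mul_le N R M G' hδ hX).trans (le_of_eq ?_)
    field_simp
  -- (iii) the one-sided smoothing: `‖𝒢′Lvᴴ − 𝒢′‖ ≤ d·Cst/N`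
  have hL : ‖G' * Lvᴴ - G'‖ ≤ d * Cst d a / N := by
    have h1 : ∀ μ, ‖fdiff (fine (R * N) M) ((R * N : ℕ) : ℂ) μ * G'ᴴ‖ ≤ Cst d a := by
      intro μ; rw [hG', (calG_isHermitian (R * N) hRN M a ha).eq]; exact opNorm_fdiff_calG_le (R * N) hRN M a ha μ
    have h2 := opNorm_Lavg_sub_one_mul_le (fine (R * N) M) R G'ᴴ hc h1
    have e : G' * Lvᴴ - G' = ((Lv - 1) * G'ᴴ)ᴴ := by
      rw [Matrix.conjTranspose_mul, Matrix.conjTranspose_conjTranspose, Matrix.conjTranspose_sub,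
        Matrix.conjTranspose_one, Matrix.mul_sub, Matrix.mul_one]
    rw [e, Matrix.l2_opNorm_conjTranspose]
    refine h2.trans (le_of_eq ?_)
    rw [hcn]; field_simp
  -- (iv) `E₁ := Q 𝒢′ Lvᴴ Qᴴ − R^{-d}𝒢`, `‖E₁‖ ≤ R^{-d}(CQ + d Cst)/N`
  have hE1 : ‖Q * (G' * Lvᴴ) * Qᴴ - ((R : ℂ) ^ d)⁻¹ • G‖ ≤ ((R : ℝ) ^ d)⁻¹ * (CQ d a + d * Cst d a) / N := by
    have e : Q * (G' * Lvᴴ) * Qᴴ - ((R : ℂ) ^ d)⁻¹ • G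
        = Q * (G' * Lvᴴ - G') * Qᴴ + (Q * G' * Qᴴ - ((R : ℂ) ^ d)⁻¹ • G) := by
      simp only [Matrix.mul_sub, Matrix.sub_mul, Matrix.mul_assoc]; abel
    rw [e]
    have hQn := opNorm_Qavg_le N R M
    have hQt : ‖Qᴴ‖ ≤ (Real.sqrt ((R : ℝ) ^ d))⁻¹ := by rw [Matrix.l2_opNorm_conjTranspose]; exact hQn
    have hc0 : 0 ≤ (Real.sqrt ((R : ℝ) ^ d))⁻¹ := inv_nonneg.mpr (Real.sqrt_nonneg _)
    have hcc : (Real.sqrt ((R : ℝ) ^ d))⁻¹ * (Real.sqrt ((R : ℝ) ^ d))⁻¹ = ((R : ℝ) ^ d)⁻¹ := by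
      rw [← mul_inv, hsq]
    have hL0 : 0 ≤ d * Cst d a / N := by positivity
    have hT1 : ‖Q * (G' * Lvᴴ - G') * Qᴴ‖ ≤ ((R : ℝ) ^ d)⁻¹ * (d * Cst d a / N) := by
      calc ‖Q * (G' * Lvᴴ - G') * Qᴴ‖ ≤ ‖Q‖ * ‖G' * Lvᴴ - G'‖ * ‖Qᴴ‖ :=
            (Matrix.l2_opNorm_mul _ _).trans (mul_le_mul_of_nonneg_right (Matrix.l2_opNorm_mul _ _) (norm_nonneg _))
        _ ≤ (Real.sqrt ((R : ℝ) ^ d))⁻¹ * (d * Cst d a / N) * (Real.sqrt ((R : ℝ) ^ d))⁻¹ :=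
            mul_le_mul (mul_le_mul hQn hL (norm_nonneg _) hc0) hQt (norm_nonneg _) (mul_nonneg hc0 hL0)
        _ = ((R : ℝ) ^ d)⁻¹ * (d * Cst d a / N) := by rw [mul_comm _ (d * Cst d a / N), mul_assoc, hcc, mul_comm]
    have hT2 := opNorm_Qavg_calG_rate N R M hN hR hRN a ha
    calc _ ≤ _ := norm_add_le _ _
      _ ≤ ((R : ℝ) ^ d)⁻¹ * (d * Cst d a / N) + ((R : ℝ) ^ d)⁻¹ * CQ d a / N := add_le_add hT1 hT2
      _ = ((R : ℝ) ^ d)⁻¹ * (CQ d a + d * Cst d a) / N := by ring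
  -- (v) the decomposition `𝒢′QBᴴ − Qᴴ𝒢 = (1 − Π)𝒢′QBᴴ + R^d Qᴴ E₁`
  have hPi : Pi N R M * G' * (QB N R M)ᴴ = ((R : ℂ) ^ d) • (Qᴴ * (Q * (G' * Lvᴴ) * Qᴴ)) := by
    rw [QB, Matrix.conjTranspose_mul, Pi]
    simp only [Matrix.smul_mul, Matrix.mul_assoc, hQ, hLv]
  have e : G' * (QB N R M)ᴴ - Qᴴ * G
      = (1 - Pi N R M) * G' * (QB N R M)ᴴ + ((R : ℂ) ^ d) • (Qᴴ * (Q * (G' * Lvᴴ) * Qᴴ - ((R : ℂ) ^ d)⁻¹ • G)) := by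
    rw [Matrix.sub_mul, Matrix.sub_mul, Matrix.one_mul, hPi, Matrix.mul_sub, smul_sub, Matrix.mul_smul, smul_smul,
      mul_inv_cancel₀ hRdC, one_smul]
    abel
  rw [e]
  have hQBt : ‖(QB N R M)ᴴ‖ ≤ (Real.sqrt ((R : ℝ) ^ d))⁻¹ := by
    rw [Matrix.l2_opNorm_conjTranspose]; exact opNorm_QB_le N R M
  have hQt : ‖Qᴴ‖ ≤ (Real.sqrt ((R : ℝ) ^ d))⁻¹ := by rw [Matrix.l2_opNorm_conjTranspose]; exact opNorm_Qavg_le N R M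
  have hP0 : 0 ≤ 2 * d * Cst d a / N := by positivity
  have hA : ‖(1 - Pi N R M) * G' * (QB N R M)ᴴ‖ ≤ (2 * d * Cst d a / N) * (Real.sqrt ((R : ℝ) ^ d))⁻¹ :=
    (Matrix.l2_opNorm_mul _ _).trans (mul_le_mul hP hQBt (norm_nonneg _) hP0)
  have hB : ‖((R : ℂ) ^ d) • (Qᴴ * (Q * (G' * Lvᴴ) * Qᴴ - ((R : ℂ) ^ d)⁻¹ • G))‖
      ≤ (R : ℝ) ^ d * ((Real.sqrt ((R : ℝ) ^ d))⁻¹ * (((R : ℝ) ^ d)⁻¹ * (CQ d a + d * Cst d a) / N)) := by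
    rw [norm_smul, norm_pow, Complex.norm_natCast]
    refine mul_le_mul_of_nonneg_left ?_ hRd.le
    have h0 : 0 ≤ ((R : ℝ) ^ d)⁻¹ * (CQ d a + d * Cst d a) / N := by
      have := CT_nonneg d a; have : 0 ≤ CQ d a := by rw [CQ]; positivity
      positivity
    exact (Matrix.l2_opNorm_mul _ _).trans (mul_le_mul hQt hE1 (norm_nonneg _) (inv_nonneg.mpr (Real.sqrt_nonneg _)))
  calc _ ≤ _ := norm_add_le _ _
    _ ≤ (2 * d * Cst d a / N) * (Real.sqrt ((R : ℝ) ^ d))⁻¹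
        + (R : ℝ) ^ d * ((Real.sqrt ((R : ℝ) ^ d))⁻¹ * (((R : ℝ) ^ d)⁻¹ * (CQ d a + d * Cst d a) / N)) := add_le_add hA hB
    _ = (Real.sqrt ((R : ℝ) ^ d))⁻¹ * CQH d a / N := by
        rw [CQH]
        field_simp
        ring

end TwoLevel

/-! ## The soft-minimiser tower at `U = 1`: King's pairing as an isometric injection, one step and two levels -/

section Tower

open Literature.MathematicalPhysics.QuantumFieldTheory.Balaban1983to89.B5G183RateUnitTower (lev lev_neZero)
open Summit.QuantumFields.BalabanUV.T4Continuum.CovariantAveragingTower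
open Summit.QuantumFields.BalabanUV.T4Continuum.BalabanAveragedTowerUnit

variable (L : ℕ) [NeZero L] (M : Fin d → ℕ) [hM : ∀ μ, NeZero (M μ)]

/-- identity transport of a level-`(k+1)` object to the syntactic successor level `L·n_k` (the index types are definitionally
equal; cf. `B5G183RateUnitTower.atSucc`). [folklore] -/
def atSucc' (k : ℕ) {κ : Type*} (X : Matrix (idx L M (k + 1)) κ ℂ) : Matrix (Tor (fine (L * lev L k) M) × Fin d) κ ℂ := X

/-- KING's PAIRING AS AN ISOMETRIC INJECTION `J_k = L^{d/2}·Q_Lᴴ : ℓ²(T_{L^{−k}}) → ℓ²(T_{L^{−k−1}})`: `(J_k g)(x′) = L^{−d/2} g(x)` for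
`x′ ∈ B(x)` («When x′ ∈ T_{η′}, we denote by x that point in T_η for which x′ ∈ B^n(x)»). [cite: King1986, p.664 (convention
before Prop. 3.8), (2.10) p.653] [folklore] -/
def Jpc (k : ℕ) : Matrix (Tor (fine (L * lev L k) M) × Fin d) (idx L M k) ℂ :=
  (((Real.sqrt ((L : ℝ) ^ d)) : ℝ) : ℂ) • (Qavg (lev L k) L M)ᴴ

/-- `J_kᴴ J_k = 1`: the pairing injection is an isometry (the `L`-blocks tile the finer torus, `Q_L Q_Lᴴ = L^{−d}`). [cite:
King1986, (2.10) p.653] [folklore] -/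
theorem Jpc_conjTranspose_mul_Jpc (k : ℕ) : (Jpc L M k)ᴴ * Jpc L M k = 1 := by
  have hL : (0 : ℝ) ≤ (L : ℝ) ^ d := pow_nonneg (Nat.cast_nonneg _) d
  have hLc : ((L : ℂ) ^ d) ≠ 0 := pow_ne_zero _ (by exact_mod_cast NeZero.ne L)
  have hs : star ((((Real.sqrt ((L : ℝ) ^ d)) : ℝ) : ℂ)) = (((Real.sqrt ((L : ℝ) ^ d)) : ℝ) : ℂ) := Complex.conj_ofReal _
  have hss : ((((Real.sqrt ((L : ℝ) ^ d)) : ℝ) : ℂ)) * (((Real.sqrt ((L : ℝ) ^ d)) : ℝ) : ℂ) = (L : ℂ) ^ d := by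
    rw [← Complex.ofReal_mul, Real.mul_self_sqrt hL]; push_cast; rfl
  rw [Jpc, Matrix.conjTranspose_smul, Matrix.conjTranspose_conjTranspose, hs, Matrix.smul_mul, Matrix.mul_smul, smul_smul,
    hss, Qavg_mul_conjTranspose, smul_smul, mul_inv_cancel₀ hLc, one_smul]

/-- `‖J_k‖ ≤ 1`. [folklore] -/
theorem opNorm_Jpc_le (k : ℕ) : ‖Jpc L M k‖ ≤ 1 := by
  have hL : (0 : ℝ) < (L : ℝ) ^ d := pow_pos (by exact_mod_cast Nat.pos_of_ne_zero (NeZero.ne L)) d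
  have hs0 : 0 < Real.sqrt ((L : ℝ) ^ d) := Real.sqrt_pos.mpr hL
  rw [Jpc, norm_smul, Complex.norm_real, Real.norm_of_nonneg hs0.le, Matrix.l2_opNorm_conjTranspose]
  calc Real.sqrt ((L : ℝ) ^ d) * ‖Qavg (lev L k) L M‖ ≤ Real.sqrt ((L : ℝ) ^ d) * (Real.sqrt ((L : ℝ) ^ d))⁻¹ :=
        mul_le_mul_of_nonneg_left (opNorm_Qavg_le (lev L k) L M) hs0.le
    _ = 1 := mul_inv_cancel₀ hs0.ne'

variable (a : ℝ) (ha : 0 < a)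

/-- **THE SOFT MINIMISER MAP of the `k`-step averaging at `U = 1`, in the `L²(T_η)` normalisation**:
`M̃_k = n_k^{d/2}·a·𝒢^{(L^{−k})}·QBtow_kᴴ` (`B ↦ A₀ = a n_k^d 𝒢 Q_kᴴ B`, the minimiser of the exponent of (1.68) — [B5] (1.71),
(1.74): «a⟨1, Q*QA_μ⟩ = a⟨1, A_μ⟩ = ⟨1, J_μ⟩»; King's `a_kG_kQ_k^*` (4.2) — times `n_k^{−d/2} = ‖·‖_{L²(T_η)}/‖·‖_{ℓ²}`;
`n_k^{d/2} = √((L^d)^k)`). [cite: Balaban1984PropagatorsI, (1.68)-(1.71) p.29, (1.74) p.30; King1986, (4.2) p.670] [folklore] -/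
def Mtil (k : ℕ) : Matrix (idx L M k) (idx L M 0) ℂ :=
  (((Real.sqrt (((L : ℝ) ^ d) ^ k) * a : ℝ)) : ℂ) • (calGlev L M a ha k * (Atow (QBlev L M) k)ᴴ)

/-- `‖QBtow_k‖ ≤ (√((L^d)^k))⁻¹ = n_k^{−d/2}`. [folklore] -/
theorem opNorm_Atow_QBlev_le (k : ℕ) : ‖Atow (QBlev L M) k‖ ≤ (Real.sqrt (((L : ℝ) ^ d) ^ k))⁻¹ := by
  have hL : (0 : ℝ) < (L : ℝ) ^ d := pow_pos (by exact_mod_cast Nat.pos_of_ne_zero (NeZero.ne L)) d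
  have hsq := opNorm_Atow_sq_le (QBlev L M) hL (opNorm_QBlev_sq_le L M) k
  rw [← Real.sqrt_inv, ← Real.sqrt_sq (norm_nonneg (Atow (QBlev L M) k))]
  exact Real.sqrt_le_sqrt hsq

/-- **ONE STEP OF THE MINIMISER TOWER** (`U = 1`, every `L ≥ 1`): `‖M̃_{k+1} − J_k M̃_k‖ ≤ a·CQH(d,a)·L^{−k}` — the soft
minimiser of the `(k+1)`-fold averaged theory, seen from the `k`-fold one through King's pairing, moves by `O(L^{−k})`: the
shape of [King1986] Prop. 3.8 (3.71) (printed for the scalar `a_kG_kQ_k^*`, pointwise with decay and rate `CL^{−γk}`, `γ`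
sufficiently small) in operator norm, with the full rate `L^{−k}`, for Bałaban's vector objects.  Statement and constant OURS
(v1.0.1: docstring only — no printed string is quoted here). [cite: King1986, Prop. 3.8 (3.71) p.664; Balaban1984PropagatorsI,
(1.71) p.29, (1.18) p.20, Prop. 1.1 (1.89) p.33] [folklore] -/
theorem opNorm_Mtil_succ_sub_le (k : ℕ) :
    ‖atSucc' L M k (Mtil L M a ha (k + 1)) - Jpc L M k * Mtil L M a ha k‖ ≤ a * CQH d a * ((L : ℝ)⁻¹) ^ k := by
  have hL1 : 1 ≤ L := Nat.pos_of_ne_zero (NeZero.ne L)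
  have hLr : (0 : ℝ) < L := by exact_mod_cast hL1
  have hLd : (0 : ℝ) < (L : ℝ) ^ d := pow_pos hLr d
  have hk : (0 : ℝ) < ((L : ℝ) ^ d) ^ k := pow_pos hLd k
  have hn : (0 : ℝ) < (lev L k : ℕ) := by exact_mod_cast one_le_lev' L k
  have hs0 : 0 < Real.sqrt ((L : ℝ) ^ d) := Real.sqrt_pos.mpr hLd
  have ht0 : 0 < Real.sqrt (((L : ℝ) ^ d) ^ k) := Real.sqrt_pos.mpr hk
  have hst : Real.sqrt (((L : ℝ) ^ d) ^ (k + 1)) = Real.sqrt ((L : ℝ) ^ d) * Real.sqrt (((L : ℝ) ^ d) ^ k) := by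
    rw [pow_succ, mul_comm, Real.sqrt_mul hLd.le]
  -- the two terms at the syntactic successor level
  have h1 : atSucc' L M k (Mtil L M a ha (k + 1))
      = (((Real.sqrt ((L : ℝ) ^ d) * Real.sqrt (((L : ℝ) ^ d) ^ k) * a : ℝ)) : ℂ) •
          (calG (L * lev L k) (one_le_lev' L (k + 1)) M a ha * (QB (lev L k) L M)ᴴ * (Atow (QBlev L M) k)ᴴ) := by
    show (((Real.sqrt (((L : ℝ) ^ d) ^ (k + 1)) * a : ℝ)) : ℂ) •
        (calG (L * lev L k) (one_le_lev' L (k + 1)) M a ha * (Atow (QBlev L M) k * QB (lev L k) L M)ᴴ) = _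
    rw [hst, Matrix.conjTranspose_mul, ← Matrix.mul_assoc]
  have h2 : Jpc L M k * Mtil L M a ha k
      = (((Real.sqrt ((L : ℝ) ^ d) * Real.sqrt (((L : ℝ) ^ d) ^ k) * a : ℝ)) : ℂ) •
          ((Qavg (lev L k) L M)ᴴ * calG (lev L k) (one_le_lev' L k) M a ha * (Atow (QBlev L M) k)ᴴ) := by
    rw [Jpc, Mtil, calGlev, Matrix.smul_mul, Matrix.mul_smul, smul_smul, ← Matrix.mul_assoc]
    congr 1
    push_cast; ring
  rw [h1, h2, ← smul_sub, ← Matrix.sub_mul, norm_smul, Complex.norm_real, Real.norm_of_nonneg (by positivity)]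
  have hmix : ‖calG (L * lev L k) (one_le_lev' L (k + 1)) M a ha * (QB (lev L k) L M)ᴴ
        - (Qavg (lev L k) L M)ᴴ * calG (lev L k) (one_le_lev' L k) M a ha‖
      ≤ (Real.sqrt ((L : ℝ) ^ d))⁻¹ * CQH d a / (lev L k : ℕ) :=
    opNorm_calG_mul_QBH_sub_le (lev L k) L M (one_le_lev' L k) hL1 (one_le_lev' L (k + 1)) a ha
  have hA : ‖(Atow (QBlev L M) k)ᴴ‖ ≤ (Real.sqrt (((L : ℝ) ^ d) ^ k))⁻¹ := by
    rw [Matrix.l2_opNorm_conjTranspose]; exact opNorm_Atow_QBlev_le L M k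
  have hC := CQH_nonneg d a
  have h0 : 0 ≤ (Real.sqrt ((L : ℝ) ^ d))⁻¹ * CQH d a / (lev L k : ℕ) := by positivity
  calc Real.sqrt ((L : ℝ) ^ d) * Real.sqrt (((L : ℝ) ^ d) ^ k) * a *
        ‖(calG (L * lev L k) (one_le_lev' L (k + 1)) M a ha * (QB (lev L k) L M)ᴴ
          - (Qavg (lev L k) L M)ᴴ * calG (lev L k) (one_le_lev' L k) M a ha) * (Atow (QBlev L M) k)ᴴ‖
      ≤ Real.sqrt ((L : ℝ) ^ d) * Real.sqrt (((L : ℝ) ^ d) ^ k) * a *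
        (((Real.sqrt ((L : ℝ) ^ d))⁻¹ * CQH d a / (lev L k : ℕ)) * (Real.sqrt (((L : ℝ) ^ d) ^ k))⁻¹) := by
        refine mul_le_mul_of_nonneg_left ?_ (by positivity)
        exact (Matrix.l2_opNorm_mul _ _).trans (mul_le_mul hmix hA (norm_nonneg _) h0)
    _ = a * CQH d a * ((lev L k : ℕ) : ℝ)⁻¹ := by field_simp
    _ = a * CQH d a * ((L : ℝ)⁻¹) ^ k := by rw [cast_lev', inv_pow]

/-- the composite pairing injection over `n` levels, `J_{k,n} = J_{k+n−1} ⋯ J_k`. [folklore] -/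
def Jtow (k : ℕ) : (n : ℕ) → Matrix (idx L M (k + n)) (idx L M k) ℂ
  | 0 => 1
  | n + 1 => Jpc L M (k + n) * Jtow k n

/-- **TWO LEVELS OF THE MINIMISER TOWER** (`L ≥ 2`): `‖M̃_{k+n} − J_{k,n} M̃_k‖ ≤ a·CQH·L^{−k}/(1 − L^{−1})` for all `k, n` — the
(3.71)/(4.38) shape at two arbitrary finite levels (injections have norm `≤ 1`, geometric sum of the one-step bounds): the
soft minimiser maps form a CAUCHY TOWER MODULO KING's INJECTIONS. [cite: King1986, Prop. 3.8 (3.71) p.664, Lemma 4.5 (4.38)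
p.674 (shape)] [folklore] -/
theorem opNorm_Mtil_sub_Jtow_mul_le (hL : 2 ≤ L) (k n : ℕ) :
    ‖Mtil L M a ha (k + n) - Jtow L M k n * Mtil L M a ha k‖ ≤ a * CQH d a * ((L : ℝ)⁻¹) ^ k / (1 - (L : ℝ)⁻¹) := by
  have hL1 : (1 : ℝ) < L := by exact_mod_cast (lt_of_lt_of_le one_lt_two hL : 1 < L)
  have hρ0 : (0 : ℝ) ≤ (L : ℝ)⁻¹ := inv_nonneg.mpr (Nat.cast_nonneg _)
  have hρ1 : (L : ℝ)⁻¹ < 1 := inv_lt_one_of_one_lt₀ hL1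
  have hC : 0 ≤ a * CQH d a := mul_nonneg ha.le (CQH_nonneg d a)
  -- partial sums
  have main : ∀ n, ‖Mtil L M a ha (k + n) - Jtow L M k n * Mtil L M a ha k‖
      ≤ a * CQH d a * ∑ i ∈ Finset.range n, ((L : ℝ)⁻¹) ^ (k + i) := by
    intro n
    induction n with
    | zero =>
      show ‖Mtil L M a ha k - 1 * Mtil L M a ha k‖ ≤ a * CQH d a * ∑ i ∈ Finset.range 0, ((L : ℝ)⁻¹) ^ (k + i)
      rw [Matrix.one_mul, sub_self, norm_zero, Finset.range_zero, Finset.sum_empty, mul_zero]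
    | succ n ih =>
      have e : ‖Mtil L M a ha (k + (n + 1)) - Jtow L M k (n + 1) * Mtil L M a ha k‖
          = ‖(atSucc' L M (k + n) (Mtil L M a ha (k + n + 1)) - Jpc L M (k + n) * Mtil L M a ha (k + n))
            + Jpc L M (k + n) * (Mtil L M a ha (k + n) - Jtow L M k n * Mtil L M a ha k)‖ := by
        rw [Matrix.mul_sub, ← Matrix.mul_assoc, sub_add_sub_cancel]
        rfl
      rw [e, Finset.sum_range_succ, mul_add]
      calc _ ≤ ‖atSucc' L M (k + n) (Mtil L M a ha (k + n + 1)) - Jpc L M (k + n) * Mtil L M a ha (k + n)‖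
              + ‖Jpc L M (k + n) * (Mtil L M a ha (k + n) - Jtow L M k n * Mtil L M a ha k)‖ := norm_add_le _ _
        _ ≤ a * CQH d a * ((L : ℝ)⁻¹) ^ (k + n) + 1 * (a * CQH d a * ∑ i ∈ Finset.range n, ((L : ℝ)⁻¹) ^ (k + i)) := by
            refine add_le_add (opNorm_Mtil_succ_sub_le L M a ha (k + n)) ?_
            exact (Matrix.l2_opNorm_mul _ _).trans (mul_le_mul (opNorm_Jpc_le L M (k + n)) ih (norm_nonneg _) zero_le_one)
        _ = a * CQH d a * ∑ i ∈ Finset.range n, ((L : ℝ)⁻¹) ^ (k + i) + a * CQH d a * ((L : ℝ)⁻¹) ^ (k + n) := by ring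
  refine (main n).trans ?_
  have hgeom : ∑ i ∈ Finset.range n, ((L : ℝ)⁻¹) ^ (k + i) ≤ ((L : ℝ)⁻¹) ^ k / (1 - (L : ℝ)⁻¹) := by
    have e : ∑ i ∈ Finset.range n, ((L : ℝ)⁻¹) ^ (k + i) = ((L : ℝ)⁻¹) ^ k * ∑ i ∈ Finset.Ico 0 n, ((L : ℝ)⁻¹) ^ i := by
      rw [Finset.mul_sum, Finset.range_eq_Ico]
      refine Finset.sum_congr rfl fun i _ => ?_
      rw [pow_add]
    rw [e, div_eq_mul_inv]
    refine mul_le_mul_of_nonneg_left ?_ (pow_nonneg hρ0 k)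
    have h := geom_sum_Ico_le_of_lt_one hρ0 hρ1 (m := 0) (n := n)
    rw [pow_zero, one_div] at h
    exact h
  rw [mul_div_assoc]
  exact mul_le_mul_of_nonneg_left hgeom hC

end Tower

end Summit.QuantumFields.BalabanUV.T4Continuum.BalabanMinimizerLaw

end
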